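import Summits.AnomalousDissipation.AnomalousDissipation.Theorems.PumpedMirrorMirrorFloorTGSmallEnergy
import Summits.AnomalousDissipation.AnomalousDissipation.Theorems.PumpedMirrorMirrorFloorTGStressBound

/-!
# `PumpedMirror.MirrorFloorTG` (stmt-AnomalousDissipation-15372) BELOW THE EXPLICIT ENERGY LEVEL `1/(8π)`:
# the sharp Reynolds-stress bound `|I_{f_TG}(u)| ≤ 2π|u|²`, the crux verbatim for `E < 1/(8π)`, and the
# emptiness of the relaxed class there

Line `registered` of the crux, lead `prover-line-stmt-AnomalousDissipation-15372-c2-0` (continuation c2,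
2026-08-17); supports stmt-AnomalousDissipation-15372. The landed `PumpedMirrorMirrorFloorTGSmallEnergy.lean`
(lead c1, p146438) settles the crux below a NON-EXPLICIT level `E₁ = 1/(16(C_TG+1))`, `C_TG = sup_x Σᵢ‖∂ᵢf_TG(x)‖`
(numerically `≈ 2·10⁻³`). This file replaces `C_TG` by the SHARP constant of the stress bound and makes the
settled part of the `E`-axis explicit and twenty times larger:

* engine (imported, `PumpedMirrorMirrorFloorTGStressBound.lean`): the sharp pointwise bound
  `|⟪∇f_TG(x)v, v⟫| ≤ 2π|v|²` and `abs_inertialPairing_tgForce_le : |I_{f_TG}(u)| ≤ 2π‖u‖²` on `L²`.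
* §5 `mirrorFloorTG_below_inv_eight_pi` — THE CRUX VERBATIM with the one extra hypothesis `E < 1/(8π)`
  (`0.0397 < 1/(8π) < 0.0398`, `inv_eight_pi_bounds`), by the explicit ν-INDEPENDENT certificate `Φ₁` = work
  functional, `θ₁ = 0`, `ε₀ = (¼ − 2πE)/2`, `ν₀ = (¼ − 2πE)/(24π²(√E‖f_TG‖₂ + 1))`.
* §7 `quarter_le_of_relaxed_explicit`, `fixedViscosity_floor_explicit` — the `O(ν)` free floor with the explicit constant
  `ε(μ) ≥ (π/4)ν` for `ν ≤ 1/64` (every relaxed statistic, symmetric or not; the landed `fixedViscosity_floor` had a non-explicit `c`).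
* §8 `abs_inertialPairing_le_of_pointwise`, `floor_uniform_of_stressBound` — PLUG-IN form: any smooth solenoidal `w` with a
  pointwise bound `|⟪∇w(x)v,v⟫| ≤ K|v|²` certifies the crux uniformly below `(f_TG,w)/K` (the reach of all such linear
  certificates is the LP value `E_lin`, see below).
* §6 `relaxed_empty_below_inv_eight_pi`, `mirrorLawsLoudTG_below_inv_eight_pi` — dual side: NO relaxed
  statistic of `NS_ν(f_TG)` (symmetric or not, leaky or not) is carried by a ball `|u|² ≤ ρ < 1/(8π)` once
  `ν < ν₀(ρ)`; the registered open stub S3 (`stub_mirrorLawsLoudTG`) therefore holds below `1/(8π)` vacuously, and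
  every refutation of the crux is a family `ν_j → 0` of relaxed K-statistics at a level `E ≥ 1/(8π)`.

Why `1/(8π)` is where THIS certificate stops (not formalised; recorded for the planners): the work functional is
linear, so its floor Lagrangian is controlled by the stress term alone, `inf_u I_{f_TG}(u) = −2πE` on the ball
(packets polarised along the compressive eigenvector of `Def f_TG` at a stagnation point); the reach of ALL
stress-level (linear-test) certificates is the value `E_lin = max{(f_TG,w) : w ∈ 𝒱, Def w ≽ −I}` of a linear
programme, `1/(8π) ≤ E_lin ≤ 1/π`, above which only genuinely nonlinear (NS-dynamical) test functionals can work.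

References: Foias–Manley–Rosa–Temam 2001, Ch. IV §1.2 (stationary statistical solutions, the work functional);
Tobasco–Goluskin–Doering, Phys. Lett. A 382 (2018) (auxiliary functionals); Brachet et al., J. Fluid Mech. 130
(1983) §2 (the Taylor–Green symmetries and stagnation points).
-/

noncomputable section

-- `Summit.<Summit>.<Problem>` is the tree's mandated summit-side namespace (CONVENTIONS §2); for this single-conjunct
-- summit the two coincide, so the duplicate namespace component is deliberate.
set_option linter.dupNamespace false

namespace Summit.AnomalousDissipation.AnomalousDissipation.Theorems.PumpedMirrorMirrorFloorTG

open MeasureTheory Filter Topology UnitAddTorus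
open scoped InnerProductSpace RealInnerProductSpace ENNReal NNReal ComplexConjugate
open Literature.Analysis.FunctionSpaces Literature.Analysis.FunctionSpaces.Torus Literature.Analysis.FluidPDE
open Summit.AnomalousDissipation.AnomalousDissipation.Theses.PumpedMirror
open Summit.AnomalousDissipation.AnomalousDissipation.Theorems.TaylorGreenLoudGalerkinStates.Negative
  (tgForce tgShell tgCoeff tgForce_eq_realTrigPoly isSmooth_tgForce isDivFree_tgForce hasZeroMean_tgForce
    integral_norm_sq_tgForce continuous_tgForce sum_tgShell_prod mFourier_three)
open Summit.AnomalousDissipation.AnomalousDissipation.Theorems.TaylorCertificatesFloorCertificate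
  (eigenforce_exists_workTest eigenforce_nsGeneratorPairing_self)
open Summit.AnomalousDissipation.AnomalousDissipation.Theorems.GPStatisticalRigidity.Negative
  (integrable_norm_sq_of_ensembleEnstrophy_lt_top)

/-! ## §5 THE CRUX BELOW `1/(8π)`: an explicit, ν-independent certificate

At the work functional (`Φ'(u) = f_TG` on the ball) with `θ = 0` the floor Lagrangian is
`ν‖∇u‖² + ¼ − 12π²ν(u,f_TG) + I_{f_TG}(u) ≥ ¼ − 2πE − 12π²ν·√E‖f_TG‖₂`, so for `E < 1/(8π)` the floor
`ε₀ = (¼ − 2πE)/2 > 0` holds at EVERY state of the ball for `ν < ν₀(E)`, one certificate for all `ν`. -/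

/-- **Uniform floor below `1/(8π)`.** For `0 < E < 1/(8π)` ONE cylindrical test functional (the work functional
on the ball) certifies `(¼ − 2πE)/2 ≤ ν‖∇u‖² + ⟨F_ν(u), Φ'(u)⟩` at every `u ∈ H` with `|u|² ≤ E`, for every
`0 < ν < ν₀(E)`. -/
theorem floor_uniform_below_inv_eight_pi (E : ℝ) (hE : 0 < E) (hE1 : E < 1 / (8 * Real.pi)) :
    ∃ (Φ : Torus.CylindricalTest (Fin 3)) (ν₀ : ℝ), 0 < ν₀ ∧
      (∀ u : Torus.energySpace (Fin 3), ‖u‖ ^ 2 ≤ E → Φ.grad u = tgForce) ∧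
      ∀ ν : ℝ, 0 < ν → ν < ν₀ → ∀ u : Torus.energySpace (Fin 3), ‖u‖ ^ 2 ≤ E →
        (4⁻¹ - 2 * Real.pi * E) / 2 ≤
          ν * (Torus.eGradNormSq (u.1 : UnitAddTorus (Fin 3) → EuclideanSpace ℝ (Fin 3))).toReal +
            Torus.nsGeneratorPairing ν tgForce u (Φ.grad u) := by
  obtain ⟨Φ, hΦ⟩ := eigenforce_exists_workTest E isSmooth_tgForce isDivFree_tgForce hasZeroMean_tgForce
  set M : ℝ := ‖(isSmooth_tgForce.memLp 2).toLp tgForce‖ with hM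
  have hM0 : 0 ≤ M := norm_nonneg _
  -- the margin
  set m : ℝ := 4⁻¹ - 2 * Real.pi * E with hm
  have hm0 : 0 < m := by
    have h1 : 2 * Real.pi * E < 2 * Real.pi * (1 / (8 * Real.pi)) := mul_lt_mul_of_pos_left hE1 Real.two_pi_pos
    have h2 : 2 * Real.pi * (1 / (8 * Real.pi)) = 4⁻¹ := by field_simp; ring
    linarith
  refine ⟨Φ, m / (2 * (12 * Real.pi ^ 2) * (Real.sqrt E * M + 1)), by positivity, hΦ, ?_⟩
  intro ν hν hνlt u hu
  rw [hΦ u hu, eigenforce_nsGeneratorPairing_self ν (12 * Real.pi ^ 2) laplacian_tgForce_apply u,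
    integral_norm_sq_tgForce]
  have hD : 0 ≤ ν * (Torus.eGradNormSq (u.1 : UnitAddTorus (Fin 3) → EuclideanSpace ℝ (Fin 3))).toReal := by
    positivity
  -- the stress term: `I ≥ -2πE`
  have hI : -(2 * Real.pi * E) ≤ Torus.inertialPairing u.1 tgForce := by
    have h1 := abs_inertialPairing_tgForce_le_energy u
    have h2 : 2 * Real.pi * ‖u‖ ^ 2 ≤ 2 * Real.pi * E := mul_le_mul_of_nonneg_left hu Real.two_pi_pos.le
    have h3 := neg_abs_le (Torus.inertialPairing u.1 tgForce)
    linarith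
  -- the viscous cross term: `|12π²ν (u,f)| ≤ m/2`
  have hP : |ν * (-(12 * Real.pi ^ 2) * Torus.pairing u.1 tgForce)| ≤ m / 2 := by
    have h1 : |Torus.pairing u.1 tgForce| ≤ Real.sqrt E * M := by
      refine (Torus.abs_pairing_coe_le (isSmooth_tgForce.memLp 2) u).trans (mul_le_mul_of_nonneg_right ?_ hM0)
      rw [← Real.sqrt_sq (norm_nonneg u)]
      exact Real.sqrt_le_sqrt hu
    rw [abs_mul, abs_mul, abs_of_pos hν, abs_neg, abs_of_pos (by positivity : (0 : ℝ) < 12 * Real.pi ^ 2),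
      ← mul_assoc]
    have h2 : ν * (12 * Real.pi ^ 2) * (Real.sqrt E * M + 1) ≤ m / 2 := by
      have h3 : ν * (2 * (12 * Real.pi ^ 2) * (Real.sqrt E * M + 1)) ≤ m := by
        rw [← le_div_iff₀ (by positivity)]; exact le_of_lt hνlt
      nlinarith
    calc ν * (12 * Real.pi ^ 2) * |Torus.pairing u.1 tgForce|
        ≤ ν * (12 * Real.pi ^ 2) * (Real.sqrt E * M) := by
          exact mul_le_mul_of_nonneg_left h1 (by positivity)
      _ ≤ ν * (12 * Real.pi ^ 2) * (Real.sqrt E * M + 1) := by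
          exact mul_le_mul_of_nonneg_left (by linarith) (by positivity)
      _ ≤ m / 2 := h2
  have hP' := neg_abs_le (ν * (-(12 * Real.pi ^ 2) * Torus.pairing u.1 tgForce))
  linarith

/-- **`MirrorFloorTG` below `1/(8π)`** — the crux VERBATIM with the single extra hypothesis `E < 1/(8π)`
(`≈ 3.98·10⁻²`; the landed `mirrorFloorTG_smallEnergy` had a non-explicit `E₁ = 1/(16(C_TG+1)) ≈ 2·10⁻³`).
The certificate is the work functional with `θ₁ = 0` and `ε₀ = (¼ − 2πE)/2`; the mirror symmetry and the finite
enstrophy are not used. The level `1/(8π) = ‖f_TG‖²/max‖Def f_TG‖_op` is exactly where the work-functional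
certificate stops: above it a genuinely different (nonlinear, `ν`-dependent) `Φ` is required. -/
theorem mirrorFloorTG_below_inv_eight_pi :
    ∀ f : UnitAddTorus (Fin 3) → EuclideanSpace ℝ (Fin 3), f = (fun x => !₂[(fourier 1 (x 0) : ℂ).im * (fourier 1 (x 1) : ℂ).re * (fourier 1 (x 2) : ℂ).re, -((fourier 1 (x 0) : ℂ).re * (fourier 1 (x 1) : ℂ).im * (fourier 1 (x 2) : ℂ).re), (0 : ℝ)]) → ∀ E : ℝ, 0 < E → E < 1 / (8 * Real.pi) → ∃ (ε₀ ν₀ : ℝ), 0 < ε₀ ∧ 0 < ν₀ ∧ ∀ ν : ℝ, 0 < ν → ν < ν₀ → ∃ (Φ₁ : Literature.Analysis.FluidPDE.Torus.CylindricalTest (Fin 3)) (θ₁ : ℝ), θ₁ ≤ 0 ∧ ∀ u : Literature.Analysis.FunctionSpaces.Torus.energySpace (Fin 3), let uf : UnitAddTorus (Fin 3) → EuclideanSpace ℝ (Fin 3) := ((u : MeasureTheory.Lp (EuclideanSpace ℝ (Fin 3)) 2 (MeasureTheory.volume : MeasureTheory.Measure (UnitAddTorus (Fin 3)))) : UnitAddTorus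 (Fin 3) → EuclideanSpace ℝ (Fin 3)); let D : ℝ := ν * (Literature.Analysis.FunctionSpaces.Torus.eGradNormSq uf).toReal; let P : ℝ := Literature.Analysis.FluidPDE.Torus.pairing (u : MeasureTheory.Lp (EuclideanSpace ℝ (Fin 3)) 2 (MeasureTheory.volume : MeasureTheory.Measure (UnitAddTorus (Fin 3)))) f - D; (∀ i j : Fin 3, (fun x => uf (Function.update x i (-x i)) j) =ᵐ[MeasureTheory.volume] (fun x => if j = i then -(uf x j) else uf x j)) → Literature.Analysis.FunctionSpaces.Torus.eGradNormSq uf ≠ ⊤ → ‖u‖ ^ 2 ≤ E → ε₀ ≤ D + Literature.Analysis.FluidPDE.Torus.nsGeneratorPairing ν f u (Φ₁.grad u) + 2 * θ₁ * P := by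
  intro f hf E hE hE1
  have hf' : f = tgForce := hf
  subst hf'
  obtain ⟨Φ, ν₀, hν₀, -, hfloor⟩ := floor_uniform_below_inv_eight_pi E hE hE1
  have hm0 : 0 < (4⁻¹ - 2 * Real.pi * E) / 2 := by
    have h1 : 2 * Real.pi * E < 2 * Real.pi * (1 / (8 * Real.pi)) := mul_lt_mul_of_pos_left hE1 Real.two_pi_pos
    have h2 : 2 * Real.pi * (1 / (8 * Real.pi)) = 4⁻¹ := by field_simp; ring
    linarith
  refine ⟨(4⁻¹ - 2 * Real.pi * E) / 2, ν₀, hm0, hν₀, fun ν hν hνlt => ⟨Φ, 0, le_rfl, fun u _ _ hu => ?_⟩⟩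
  have := hfloor ν hν hνlt u hu
  simp only [mul_zero, zero_mul, add_zero]
  exact this

/-! ## §6 THE DUAL SIDE BELOW `1/(8π)`: the relaxed class is EMPTY, so S3 holds there vacuously

Anti-pumping `¼ + ∫I dμ ≤ ½(12π²ν ε(μ))^{1/2}` (`antiPumping_tg`), the sharp stress bound `∫I dμ ≥ −2πρ` and the
energy inequality `ε(μ) ≤ ∫(u,f_TG)dμ ≤ √ρ ‖f_TG‖₂` give `¼ − 2πρ ≤ ½(12π²ν √ρ‖f_TG‖₂)^{1/2} → 0`: no relaxed
statistic of NS_ν(f_TG) (symmetric or not) lives on a ball of radius² `ρ < 1/(8π)` once `ν < ν₀(ρ)`. -/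

/-- **No relaxed statistic below `1/(8π)`.** For every `ρ < 1/(8π)` there is `ν₀ > 0` such that for
`0 < ν < ν₀` no probability measure on `H` carried by `{|u|² ≤ ρ}` with finite mean enstrophy, the cylindrical
Liouville identities of `NS_ν(f_TG)`, integrable work and `ε(μ) ≤ ∫(u,f_TG)dμ` exists. -/
theorem relaxed_empty_below_inv_eight_pi (ρ : ℝ) (hρ1 : ρ < 1 / (8 * Real.pi)) :
    ∃ ν₀ : ℝ, 0 < ν₀ ∧ ∀ (ν : ℝ) (μ : Measure (Torus.energySpace (Fin 3))), 0 < ν → ν < ν₀ →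
      IsProbabilityMeasure μ → (∀ᵐ u ∂μ, ‖u‖ ^ 2 ≤ ρ) → Torus.ensembleEnstrophy μ < ⊤ →
      (∀ Φ : Torus.CylindricalTest (Fin 3),
        Integrable (fun u => Torus.nsGeneratorPairing ν tgForce u (Φ.grad u)) μ ∧
          ∫ u, Torus.nsGeneratorPairing ν tgForce u (Φ.grad u) ∂μ = 0) →
      Integrable (fun u : Torus.energySpace (Fin 3) => Torus.pairing u.1 tgForce) μ →
      Torus.ensembleDissipation ν μ ≤ ∫ u, Torus.pairing u.1 tgForce ∂μ → False := by
  set M : ℝ := ‖(isSmooth_tgForce.memLp 2).toLp tgForce‖ with hM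
  have hM0 : 0 ≤ M := norm_nonneg _
  set m : ℝ := 4⁻¹ - 2 * Real.pi * ρ with hm
  have hm0 : 0 < m := by
    have h1 : 2 * Real.pi * ρ < 2 * Real.pi * (1 / (8 * Real.pi)) := mul_lt_mul_of_pos_left hρ1 Real.two_pi_pos
    have h2 : 2 * Real.pi * (1 / (8 * Real.pi)) = 4⁻¹ := by field_simp; ring
    linarith
  -- `ν₀`: make `12π²ν(√ρ M + 1) ≤ m²`, so that the square-root term is `≤ m/2`
  refine ⟨m ^ 2 / (12 * Real.pi ^ 2 * (Real.sqrt ρ * M + 1)), by positivity,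
    fun ν μ hν hνlt hP hball hG hL hW hEI => ?_⟩
  have hA := antiPumping_tg hν hP hball hG hL hW
  -- `∫ I ≥ -2πρ`
  have hIint : Integrable (fun u : Torus.energySpace (Fin 3) => Torus.inertialPairing u.1 tgForce) μ := by
    refine Integrable.mono' (integrable_const (2 * Real.pi * ρ))
      (Torus.continuous_inertialPairing_coe isSmooth_tgForce).aestronglyMeasurable ?_
    filter_upwards [hball] with u hu
    rw [Real.norm_eq_abs]
    exact (abs_inertialPairing_tgForce_le_energy u).trans (mul_le_mul_of_nonneg_left hu Real.two_pi_pos.le)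
  have hI : -(2 * Real.pi * ρ) ≤ ∫ u, Torus.inertialPairing u.1 tgForce ∂μ := by
    have h1 : ∫ _ : Torus.energySpace (Fin 3), -(2 * Real.pi * ρ) ∂μ ≤ ∫ u, Torus.inertialPairing u.1 tgForce ∂μ := by
      refine integral_mono_ae (integrable_const _) hIint ?_
      filter_upwards [hball] with u hu
      have := neg_abs_le (Torus.inertialPairing u.1 tgForce)
      linarith [(abs_inertialPairing_tgForce_le_energy u).trans (mul_le_mul_of_nonneg_left hu Real.two_pi_pos.le)]
    simpa using h1
  -- `ε ≤ ∫ (u,f) ≤ √ρ M`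
  have hWle : ∫ u, Torus.pairing u.1 tgForce ∂μ ≤ Real.sqrt ρ * M := by
    have h1 : ∫ u, Torus.pairing u.1 tgForce ∂μ ≤ ∫ _ : Torus.energySpace (Fin 3), Real.sqrt ρ * M ∂μ := by
      refine integral_mono_ae hW (integrable_const _) ?_
      filter_upwards [hball] with u hu
      refine (le_abs_self _).trans ((Torus.abs_pairing_coe_le (isSmooth_tgForce.memLp 2) u).trans ?_)
      refine mul_le_mul_of_nonneg_right ?_ hM0
      rw [← Real.sqrt_sq (norm_nonneg u)]
      exact Real.sqrt_le_sqrt hu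
    simpa using h1
  have hε := hEI.trans hWle
  have hε0 : 0 ≤ Torus.ensembleDissipation ν μ := by rw [Torus.ensembleDissipation]; positivity
  -- the square-root term is `< m/2`... precisely `≤ m/2` from `12π²ν ε ≤ 12π²ν(√ρM+1) < m²`
  have hsq : 2⁻¹ * Real.sqrt (12 * Real.pi ^ 2 * ν * Torus.ensembleDissipation ν μ) < 2⁻¹ * m := by
    have h1 : 12 * Real.pi ^ 2 * ν * Torus.ensembleDissipation ν μ < m ^ 2 := by
      have a1 : 12 * Real.pi ^ 2 * ν * Torus.ensembleDissipation ν μ ≤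
          12 * Real.pi ^ 2 * ν * (Real.sqrt ρ * M + 1) :=
        mul_le_mul_of_nonneg_left (hε.trans (by linarith)) (by positivity)
      have a2 : 12 * Real.pi ^ 2 * ν * (Real.sqrt ρ * M + 1) < m ^ 2 := by
        have := (lt_div_iff₀ (by positivity : (0 : ℝ) < 12 * Real.pi ^ 2 * (Real.sqrt ρ * M + 1))).1 hνlt
        nlinarith
      exact a1.trans_lt a2
    have h2 : Real.sqrt (12 * Real.pi ^ 2 * ν * Torus.ensembleDissipation ν μ) < m := by
      rw [← Real.sqrt_sq hm0.le]
      exact Real.sqrt_lt_sqrt (by positivity) h1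
    linarith
  linarith

/-- **S3 (`stub_mirrorLawsLoudTG`) below `1/(8π)`** — the registered stub's statement VERBATIM with the single
extra hypothesis `E < 1/(8π)`: true, vacuously (no relaxed statistic of energy `< 1/(8π)` exists, symmetric or
not). Every refutation of the crux must therefore be a family `ν_j → 0` of relaxed K-statistics at a level
`E ≥ 1/(8π)`. -/
theorem mirrorLawsLoudTG_below_inv_eight_pi :
    ∀ f : UnitAddTorus (Fin 3) → EuclideanSpace ℝ (Fin 3),
      f = (fun x => !₂[(fourier 1 (x 0) : ℂ).im * (fourier 1 (x 1) : ℂ).re * (fourier 1 (x 2) : ℂ).re,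
        -((fourier 1 (x 0) : ℂ).re * (fourier 1 (x 1) : ℂ).im * (fourier 1 (x 2) : ℂ).re), (0 : ℝ)]) →
    ∀ E : ℝ, 0 < E → E < 1 / (8 * Real.pi) → ∃ ε₀ ν₀ : ℝ, 0 < ε₀ ∧ 0 < ν₀ ∧ ∀ ν : ℝ, 0 < ν → ν < ν₀ →
      ∀ μ : Measure (Torus.energySpace (Fin 3)), IsProbabilityMeasure μ →
        (∀ᵐ u ∂μ, ∀ i j : Fin 3,
          (fun x => (u.1 : UnitAddTorus (Fin 3) → EuclideanSpace ℝ (Fin 3)) (Function.update x i (-x i)) j)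
            =ᵐ[volume]
          (fun x => if j = i then -((u.1 : UnitAddTorus (Fin 3) → EuclideanSpace ℝ (Fin 3)) x j)
            else (u.1 : UnitAddTorus (Fin 3) → EuclideanSpace ℝ (Fin 3)) x j)) →
        (∀ᵐ u ∂μ, ‖u‖ ^ 2 ≤ E) →
        Torus.ensembleEnstrophy μ < ⊤ →
        (∀ Φ : Torus.CylindricalTest (Fin 3),
          Integrable (fun u => Torus.nsGeneratorPairing ν f u (Φ.grad u)) μ ∧
            ∫ u, Torus.nsGeneratorPairing ν f u (Φ.grad u) ∂μ = 0) →
        Integrable (fun u : Torus.energySpace (Fin 3) => Torus.pairing u.1 f) μ →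
        Torus.ensembleDissipation ν μ ≤ ∫ u, Torus.pairing u.1 f ∂μ →
        ε₀ ≤ Torus.ensembleDissipation ν μ := by
  intro f hf E hE hE1
  have hf' : f = tgForce := hf
  subst hf'
  obtain ⟨ν₀, hν₀, h⟩ := relaxed_empty_below_inv_eight_pi E hE1
  refine ⟨1, ν₀, one_pos, hν₀, fun ν hν hνlt μ hP _ hball hG hL hW hEI => ?_⟩
  exact (h ν μ hν hνlt hP hball hG hL hW hEI).elim

/-- **The inhabitation threshold, recorded numerically**: `1/(8π) > 0.0397` (and `< 0.0398`). [folklore] -/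
theorem inv_eight_pi_bounds : (0.0397 : ℝ) < 1 / (8 * Real.pi) ∧ 1 / (8 * Real.pi) < 0.0398 := by
  constructor
  · rw [lt_div_iff₀ (by positivity)]
    nlinarith [Real.pi_lt_d4]
  · rw [div_lt_iff₀ (by positivity)]
    nlinarith [Real.pi_gt_d6]

/-! ## §7 The `O(ν)` free floor with an explicit constant: `ε(μ) ≥ (π/4) ν` for `ν ≤ 1/64`

`fixedViscosity_floor` (p146438) gives `ε(μ) ≥ cν` with a non-explicit `c = min(1, π²/(2(C_TG+1)))`; with the sharp stress bound the
implicit inequality reads `¼ ≤ ε/(2πν) + ½(12π²νε)^{1/2}` and yields `c = π/4`. -/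

/-- **The implicit fixed-viscosity inequality, explicit form**: every relaxed statistic of `NS_ν(f_TG)` (no symmetry, no energy
inequality) has `¼ ≤ ε(μ)/(2πν) + ½ (12π²ν ε(μ))^{1/2}`. -/
theorem quarter_le_of_relaxed_explicit {ν ρ : ℝ} (hν : 0 < ν) {μ : Measure (Torus.energySpace (Fin 3))}
    (hP : IsProbabilityMeasure μ) (hball : ∀ᵐ u ∂μ, ‖u‖ ^ 2 ≤ ρ) (hG : Torus.ensembleEnstrophy μ < ⊤)
    (hL : ∀ Φ : Torus.CylindricalTest (Fin 3),
      Integrable (fun u => Torus.nsGeneratorPairing ν tgForce u (Φ.grad u)) μ ∧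
        ∫ u, Torus.nsGeneratorPairing ν tgForce u (Φ.grad u) ∂μ = 0)
    (hW : Integrable (fun u : Torus.energySpace (Fin 3) => Torus.pairing u.1 tgForce) μ) :
    4⁻¹ ≤ Torus.ensembleDissipation ν μ / (2 * Real.pi * ν) +
      2⁻¹ * Real.sqrt (12 * Real.pi ^ 2 * ν * Torus.ensembleDissipation ν μ) := by
  have hA := antiPumping_tg hν hP hball hG hL hW
  have hIint : Integrable (fun u : Torus.energySpace (Fin 3) => Torus.inertialPairing u.1 tgForce) μ := by
    refine Integrable.mono' ((integrable_norm_sq_of_ensembleEnstrophy_lt_top μ hG).const_mul (2 * Real.pi))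
      (Torus.continuous_inertialPairing_coe isSmooth_tgForce).aestronglyMeasurable ?_
    exact ae_of_all _ fun u => by rw [Real.norm_eq_abs]; exact abs_inertialPairing_tgForce_le_energy u
  have hI : -(2 * Real.pi * ∫ u, ‖u‖ ^ 2 ∂μ) ≤ ∫ u, Torus.inertialPairing u.1 tgForce ∂μ := by
    rw [← integral_const_mul, ← integral_neg]
    refine integral_mono ((integrable_norm_sq_of_ensembleEnstrophy_lt_top μ hG).const_mul _).neg hIint fun u => ?_
    have := neg_abs_le (Torus.inertialPairing u.1 tgForce)
    dsimp only
    linarith [abs_inertialPairing_tgForce_le_energy u]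
  have hE := integral_norm_sq_le_ensembleEnstrophy μ hG
  have hE' : 2 * Real.pi * ∫ u, ‖u‖ ^ 2 ∂μ ≤ Torus.ensembleDissipation ν μ / (2 * Real.pi * ν) := by
    rw [Torus.ensembleDissipation, le_div_iff₀ (by positivity)]
    have hpi := Real.pi_pos
    nlinarith [hE, mul_pos hpi hν]
  linarith

/-- **THE FREE FLOOR IS `≥ (π/4)ν`.** For every `0 < ν ≤ 1/64`, every relaxed statistic of `NS_ν(f_TG)` on any ball — probability,
finite mean enstrophy, cylindrical Liouville identities, integrable work; no symmetry, no energy inequality — dissipates at least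
`(π/4) ν` (`≈ 0.785 ν`). -/
theorem fixedViscosity_floor_explicit {ν ρ : ℝ} (hν : 0 < ν) (hν64 : ν ≤ 64⁻¹) {μ : Measure (Torus.energySpace (Fin 3))}
    (hP : IsProbabilityMeasure μ) (hball : ∀ᵐ u ∂μ, ‖u‖ ^ 2 ≤ ρ) (hG : Torus.ensembleEnstrophy μ < ⊤)
    (hL : ∀ Φ : Torus.CylindricalTest (Fin 3),
      Integrable (fun u => Torus.nsGeneratorPairing ν tgForce u (Φ.grad u)) μ ∧
        ∫ u, Torus.nsGeneratorPairing ν tgForce u (Φ.grad u) ∂μ = 0)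
    (hW : Integrable (fun u : Torus.energySpace (Fin 3) => Torus.pairing u.1 tgForce) μ) :
    Real.pi / 4 * ν ≤ Torus.ensembleDissipation ν μ := by
  have h := quarter_le_of_relaxed_explicit hν hP hball hG hL hW
  set ε := Torus.ensembleDissipation ν μ with hε
  have hε0 : 0 ≤ ε := by rw [hε, Torus.ensembleDissipation]; positivity
  by_contra hlt
  rw [not_le] at hlt
  have hεν : ε < ν := hlt.trans_le (by nlinarith [Real.pi_le_four])
  -- the square-root term is `≤ 1/8`
  have hsq : 2⁻¹ * Real.sqrt (12 * Real.pi ^ 2 * ν * ε) ≤ 8⁻¹ := by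
    have h1 : 12 * Real.pi ^ 2 * ν * ε ≤ (16 * ν) ^ 2 := by
      have hpi : Real.pi ^ 2 ≤ 16 := by nlinarith [Real.pi_lt_four, Real.pi_pos]
      nlinarith [mul_le_mul_of_nonneg_left hεν.le (by positivity : (0 : ℝ) ≤ 12 * Real.pi ^ 2 * ν)]
    have h2 : Real.sqrt (12 * Real.pi ^ 2 * ν * ε) ≤ 16 * ν := by
      rw [← Real.sqrt_sq (by positivity : (0 : ℝ) ≤ 16 * ν)]
      exact Real.sqrt_le_sqrt h1
    nlinarith
  -- hence `ε/(2πν) ≥ 1/8`, i.e. `ε ≥ πν/4`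
  have h8 : 8⁻¹ ≤ ε / (2 * Real.pi * ν) := by linarith
  rw [le_div_iff₀ (by positivity)] at h8
  linarith

/-! ## §8 Plug-in form: ANY stress-dominated test field certifies the crux below `(f_TG, w)/K`

The reach of linear certificates is `E_lin = sup_w (f_TG,w)/K(w)`, `K(w) = max_x ‖(Def w(x))₋‖`; whoever proves a pointwise
bound `|⟪∇w(x)v,v⟫| ≤ K|v|²` for a better `w` gets the crux verbatim below `(f_TG,w)/K` from the two lemmas below. -/

/-- **Stress bound from a pointwise bound** (general test field): `|⟪∇w(x)v, v⟫| ≤ K|v|²` for all `x, v` gives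
`|I_w(u)| ≤ K‖u‖²` on `L²`. [folklore] -/
theorem abs_inertialPairing_le_of_pointwise {w : UnitAddTorus (Fin 3) → EuclideanSpace ℝ (Fin 3)} {K : ℝ}
    (hK : ∀ (x : UnitAddTorus (Fin 3)) (v : EuclideanSpace ℝ (Fin 3)), |⟪Torus.fderiv w x v, v⟫_ℝ| ≤ K * ‖v‖ ^ 2)
    (u : Lp (EuclideanSpace ℝ (Fin 3)) 2 (volume : Measure (UnitAddTorus (Fin 3)))) :
    |Torus.inertialPairing u w| ≤ K * ‖u‖ ^ 2 := by
  have hu : MemLp (u : UnitAddTorus (Fin 3) → EuclideanSpace ℝ (Fin 3)) 2 volume := Lp.memLp u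
  have hi2 : Integrable (fun x => K * ‖(u : UnitAddTorus (Fin 3) → EuclideanSpace ℝ (Fin 3)) x‖ ^ 2) volume :=
    (hu.integrable_norm_pow two_ne_zero).const_mul _
  rw [Torus.inertialPairing, ← Real.norm_eq_abs, ← Torus.integral_norm_sq_coe_eq, ← integral_const_mul]
  exact norm_integral_le_of_norm_le hi2 (ae_of_all _ fun x => by rw [Real.norm_eq_abs]; exact hK x _)

/-- **Uniform floor from a stress-dominated test field.** For a smooth, divergence-free, mean-zero `w` with
`|⟪∇w(x)v,v⟫| ≤ K|v|²` (`K ≥ 0`) and a level `E` with `K·E < (f_TG, w)`, ONE cylindrical test functional (`u ↦ (u,w)` cut off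
outside the ball) certifies `((f_TG,w) − K E)/2 ≤ ν‖∇u‖² + ⟨F_ν(u), Φ'(u)⟩` at every `u ∈ H` with `|u|² ≤ E`, for all
`0 < ν < ν₀`. With `w = f_TG`, `K = 2π` this is `floor_uniform_below_inv_eight_pi`. -/
theorem floor_uniform_of_stressBound {w : UnitAddTorus (Fin 3) → EuclideanSpace ℝ (Fin 3)} (hw : Torus.IsSmooth w)
    (hdiv : Torus.IsDivFree w) (hmean : Torus.HasZeroMean w) {K : ℝ} (hK0 : 0 ≤ K)
    (hK : ∀ (x : UnitAddTorus (Fin 3)) (v : EuclideanSpace ℝ (Fin 3)), |⟪Torus.fderiv w x v, v⟫_ℝ| ≤ K * ‖v‖ ^ 2)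
    (E : ℝ) (hcE : K * E < ∫ x, ⟪tgForce x, w x⟫_ℝ) :
    ∃ (Φ : Torus.CylindricalTest (Fin 3)) (ν₀ : ℝ), 0 < ν₀ ∧
      (∀ u : Torus.energySpace (Fin 3), ‖u‖ ^ 2 ≤ E → Φ.grad u = w) ∧
      ∀ ν : ℝ, 0 < ν → ν < ν₀ → ∀ u : Torus.energySpace (Fin 3), ‖u‖ ^ 2 ≤ E →
        ((∫ x, ⟪tgForce x, w x⟫_ℝ) - K * E) / 2 ≤
          ν * (Torus.eGradNormSq (u.1 : UnitAddTorus (Fin 3) → EuclideanSpace ℝ (Fin 3))).toReal +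
            Torus.nsGeneratorPairing ν tgForce u (Φ.grad u) := by
  obtain ⟨Φ, hΦ⟩ := eigenforce_exists_workTest E hw hdiv hmean
  set M : ℝ := ‖((hw.laplacian).memLp 2).toLp (Torus.laplacian w)‖ with hM
  have hM0 : 0 ≤ M := norm_nonneg _
  set m : ℝ := (∫ x, ⟪tgForce x, w x⟫_ℝ) - K * E with hm
  have hm0 : 0 < m := by rw [hm]; linarith
  refine ⟨Φ, m / (2 * (Real.sqrt E * M + 1)), by positivity, hΦ, fun ν hν hνlt u hu => ?_⟩
  rw [hΦ u hu, Torus.nsGeneratorPairing]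
  have hD : 0 ≤ ν * (Torus.eGradNormSq (u.1 : UnitAddTorus (Fin 3) → EuclideanSpace ℝ (Fin 3))).toReal := by
    positivity
  have hI : -(K * E) ≤ Torus.inertialPairing u.1 w := by
    have h1 := abs_inertialPairing_le_of_pointwise hK u.1
    rw [← Submodule.coe_norm] at h1
    have h3 := neg_abs_le (Torus.inertialPairing u.1 w)
    nlinarith [mul_le_mul_of_nonneg_left hu hK0]
  have hV : |ν * ∫ x, ⟪((u.1 : Lp (EuclideanSpace ℝ (Fin 3)) 2 (volume : Measure (UnitAddTorus (Fin 3)))) :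
      UnitAddTorus (Fin 3) → EuclideanSpace ℝ (Fin 3)) x, Torus.laplacian w x⟫_ℝ| ≤ m / 2 := by
    have h1 : |Torus.pairing u.1 (Torus.laplacian w)| ≤ Real.sqrt E * M := by
      refine (Torus.abs_pairing_coe_le ((hw.laplacian).memLp 2) u).trans (mul_le_mul_of_nonneg_right ?_ hM0)
      rw [← Real.sqrt_sq (norm_nonneg u)]
      exact Real.sqrt_le_sqrt hu
    rw [abs_mul, abs_of_pos hν]
    have h2 : ν * (Real.sqrt E * M + 1) ≤ m / 2 := by
      have h3 : ν * (2 * (Real.sqrt E * M + 1)) ≤ m := by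
        rw [← le_div_iff₀ (by positivity)]; exact le_of_lt hνlt
      nlinarith
    calc ν * |∫ x, ⟪((u.1 : Lp (EuclideanSpace ℝ (Fin 3)) 2 (volume : Measure (UnitAddTorus (Fin 3)))) :
          UnitAddTorus (Fin 3) → EuclideanSpace ℝ (Fin 3)) x, Torus.laplacian w x⟫_ℝ|
        ≤ ν * (Real.sqrt E * M) := mul_le_mul_of_nonneg_left h1 hν.le
      _ ≤ ν * (Real.sqrt E * M + 1) := mul_le_mul_of_nonneg_left (by linarith) hν.le
      _ ≤ m / 2 := h2
  have hV' := neg_abs_le (ν * ∫ x, ⟪((u.1 : Lp (EuclideanSpace ℝ (Fin 3)) 2 (volume : Measure (UnitAddTorus (Fin 3)))) :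
      UnitAddTorus (Fin 3) → EuclideanSpace ℝ (Fin 3)) x, Torus.laplacian w x⟫_ℝ)
  linarith

end Summit.AnomalousDissipation.AnomalousDissipation.Theorems.PumpedMirrorMirrorFloorTG

end
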